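import Literature.Barriers.CriticalPhenomena.PlaquetteWalkAngleLimitAntipodeSum
import Literature.Barriers.CriticalPhenomena.PlaquetteWalkAngleLimitPhase
import HarnessLib

/-!
# Barrier catalogue (SAWScalingLimit): the ANTIPODE-FREE CRITERION for the wound limit sum — if every level-`j` wound group member at a cell has its limit weight in
the phase set `{cζ⁴, cζ⁸, cζ¹⁶, cζ²⁸}` (or `{c, cζ⁸, cζ²⁰, cζ²⁸}`), the level-`j` wound sum vanishes iff there is NO member («ANTIPODE-FREE CRITERION»)

Companion of `PlaquetteWalkAngleLimitPhase` (`woundLimitSum`, the HALF-PLANE criterion `woundLimitSum_ne_zero_of_halfPlane`) and of `PlaquetteWalkAngleLimitAntipodeSum`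
(a finite sum of terms from an antipode-free phase set vanishes iff it is empty). The hole-column census law (FINDING-YB-HOLE-COLUMN-FOUR-PHASE) is NOT a half-plane
statement — the phases `ζ⁴, ζ⁸, ζ¹⁶, ζ²⁸` span more than a half-plane — so the assembly there needs this second criterion:

* ★ `woundLimitSum_eq_sum_disjSum` — the wound limit sum as ONE sum over the disjoint union of the two member kinds (class-`B2a` members of cost `j`; extensions
  `ext₃` of the `NS` members, of cost `j`);
* ★★★ `woundLimitSum_eq_zero_iff_of_mem_phases_above` / `_below` — if every member of cost `j` (of either kind) has limit weight in `{cζ⁴, cζ⁸, cζ¹⁶, cζ²⁸}` (resp.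
  `{c, cζ⁸, cζ²⁰, cζ²⁸}`) for one `c ≠ 0`, then **`woundLimitSum_j = 0 ⟺ there is no member of cost `j`**;
* ★★★ `woundLimitSum_ne_zero_of_mem_phases_above` / `_below` — … so ONE member makes `woundLimitSum_j ≠ 0` (hence, with `woundLimitCoeff_ne_zero_iff`, the level-`j`
  coefficient of the cleared vertex functional is non-zero).

At the hole-column cells next to the hole, `PlaquetteWalkHoleRootHoleColumnAdjacentLaw` supplies the hypothesis for the class-`B2a` kind with `c = (√2)⁷`, `j = 7`; the
class-`B2b` kind (extensions of the cost-`9` `NS` parents) is the remaining input (lane census kit j298353: the same phases).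

[GlazmanManolescu2019 §1 eq. (1), Lemma 2.1 (proof: the groups); the `Z → ∞` bookkeeping is lane plumbing.]
-/

noncomputable section

open private IsNS from Literature.Probability.RandomPlanarGeometry.YangBaxterSAWGeneralDomain

namespace Literature.Barriers.CriticalPhenomena.PlaquetteWalk

open Literature.Probability.RandomPlanarGeometry.SAW.YangBaxter
open Complex

section Criterion

variable (Dl : List Face) (a : MidEdge) (f₀ : Face)

open Classical in
/-- ★ **The wound limit sum as one sum over the two member kinds**: `woundLimitSum_j = Σ_{ω : cost j} limitWeight(ω) + Σ_{ω NS, cost(ext₃ ω) = j} limitWeight(ext₃ ω)`,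
written over the disjoint union of the two index sets. [cite: GlazmanManolescu2019, Lemma 2.1 (proof: the groups) and eq. (1)] -/
theorem woundLimitSum_eq_sum_disjSum (hr : RootedFace (dom Dl) a f₀) (j : ℕ) :
    woundLimitSum Dl a f₀ hr j =
      ∑ x ∈ (((ΩG.setB2a (dom Dl) a f₀).filter (fun ω => ¬ω.Unwound hr)).filter
            (fun ω => cost (slotOfSide ω.1) ω.2.mids = j)).disjSum
          ((((ΩG.setB2a (dom Dl) a f₀).filter (fun ω => ¬ω.Unwound hr)).filter
            (fun ω => IsNS ω hr ∧ cost (slotOfSide (ω.ext₃ hr).1) (ω.ext₃ hr).2.mids = j))),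
        Sum.elim (fun ω : ΩG (dom Dl) a f₀ => limitWeight (slotOfSide ω.1) ω.2.mids)
          (fun ω : ΩG (dom Dl) a f₀ => limitWeight (slotOfSide (ω.ext₃ hr).1) (ω.ext₃ hr).2.mids) x := by
  rw [Finset.sum_disjSum]
  simp only [Sum.elim_inl, Sum.elim_inr]
  rw [Finset.sum_filter (p := fun ω : ΩG (dom Dl) a f₀ => cost (slotOfSide ω.1) ω.2.mids = j),
    Finset.sum_filter (p := fun ω : ΩG (dom Dl) a f₀ => IsNS ω hr ∧ cost (slotOfSide (ω.ext₃ hr).1) (ω.ext₃ hr).2.mids = j),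
    ← Finset.sum_add_distrib]
  rfl

open Classical in
/-- ★★★ **THE ANTIPODE-FREE CRITERION, PHASES ABOVE THE HOLE.** If, for some `c ≠ 0`, every wound group member of cost `j` at `f₀` — the class-`B2a` members and the
extensions of the `NS` members alike — has `limitWeight ∈ {cζ⁴, cζ⁸, cζ¹⁶, cζ²⁸}`, then `woundLimitSum_j = 0` iff there is no member of cost `j`.
[cite: GlazmanManolescu2019, Lemma 2.1 (proof: the groups) and eq. (1)] -/
theorem woundLimitSum_eq_zero_iff_of_mem_phases_above (hr : RootedFace (dom Dl) a f₀) (j : ℕ) {c : ℂ} (hc : c ≠ 0)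
    (hall : ∀ ω ∈ (ΩG.setB2a (dom Dl) a f₀).filter (fun ω => ¬ω.Unwound hr),
      (cost (slotOfSide ω.1) ω.2.mids = j →
        (limitWeight (slotOfSide ω.1) ω.2.mids = c * zeta32 ^ 4 ∨ limitWeight (slotOfSide ω.1) ω.2.mids = c * zeta32 ^ 8 ∨
          limitWeight (slotOfSide ω.1) ω.2.mids = c * zeta32 ^ 16 ∨ limitWeight (slotOfSide ω.1) ω.2.mids = c * zeta32 ^ 28)) ∧
      (IsNS ω hr → cost (slotOfSide (ω.ext₃ hr).1) (ω.ext₃ hr).2.mids = j →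
        (limitWeight (slotOfSide (ω.ext₃ hr).1) (ω.ext₃ hr).2.mids = c * zeta32 ^ 4 ∨
          limitWeight (slotOfSide (ω.ext₃ hr).1) (ω.ext₃ hr).2.mids = c * zeta32 ^ 8 ∨
          limitWeight (slotOfSide (ω.ext₃ hr).1) (ω.ext₃ hr).2.mids = c * zeta32 ^ 16 ∨
          limitWeight (slotOfSide (ω.ext₃ hr).1) (ω.ext₃ hr).2.mids = c * zeta32 ^ 28))) :
    woundLimitSum Dl a f₀ hr j = 0 ↔
      ∀ ω ∈ (ΩG.setB2a (dom Dl) a f₀).filter (fun ω => ¬ω.Unwound hr),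
        cost (slotOfSide ω.1) ω.2.mids ≠ j ∧ ¬(IsNS ω hr ∧ cost (slotOfSide (ω.ext₃ hr).1) (ω.ext₃ hr).2.mids = j) := by
  rw [woundLimitSum_eq_sum_disjSum, sum_eq_zero_iff_of_mem_phases_above _ _ hc, Finset.disjSum_eq_empty, Finset.filter_eq_empty_iff,
    Finset.filter_eq_empty_iff]
  · constructor
    · rintro ⟨h1, h2⟩ ω hω; exact ⟨h1 hω, h2 hω⟩
    · intro h; exact ⟨fun ω hω => (h ω hω).1, fun ω hω => (h ω hω).2⟩
  · intro x hx
    rcases x with ω | ω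
    · rw [Finset.inl_mem_disjSum, Finset.mem_filter] at hx
      exact (hall ω hx.1).1 hx.2
    · rw [Finset.inr_mem_disjSum, Finset.mem_filter] at hx
      exact (hall ω hx.1).2 hx.2.1 hx.2.2

open Classical in
/-- ★★★ **… SO ONE MEMBER MAKES THE SUM NON-ZERO (phases above the hole).** [cite: GlazmanManolescu2019, Lemma 2.1 (proof: the groups) and eq. (1)] -/
theorem woundLimitSum_ne_zero_of_mem_phases_above (hr : RootedFace (dom Dl) a f₀) (j : ℕ) {c : ℂ} (hc : c ≠ 0)
    (hall : ∀ ω ∈ (ΩG.setB2a (dom Dl) a f₀).filter (fun ω => ¬ω.Unwound hr),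
      (cost (slotOfSide ω.1) ω.2.mids = j →
        (limitWeight (slotOfSide ω.1) ω.2.mids = c * zeta32 ^ 4 ∨ limitWeight (slotOfSide ω.1) ω.2.mids = c * zeta32 ^ 8 ∨
          limitWeight (slotOfSide ω.1) ω.2.mids = c * zeta32 ^ 16 ∨ limitWeight (slotOfSide ω.1) ω.2.mids = c * zeta32 ^ 28)) ∧
      (IsNS ω hr → cost (slotOfSide (ω.ext₃ hr).1) (ω.ext₃ hr).2.mids = j →
        (limitWeight (slotOfSide (ω.ext₃ hr).1) (ω.ext₃ hr).2.mids = c * zeta32 ^ 4 ∨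
          limitWeight (slotOfSide (ω.ext₃ hr).1) (ω.ext₃ hr).2.mids = c * zeta32 ^ 8 ∨
          limitWeight (slotOfSide (ω.ext₃ hr).1) (ω.ext₃ hr).2.mids = c * zeta32 ^ 16 ∨
          limitWeight (slotOfSide (ω.ext₃ hr).1) (ω.ext₃ hr).2.mids = c * zeta32 ^ 28)))
    (hex : ∃ ω ∈ (ΩG.setB2a (dom Dl) a f₀).filter (fun ω => ¬ω.Unwound hr),
      cost (slotOfSide ω.1) ω.2.mids = j ∨ (IsNS ω hr ∧ cost (slotOfSide (ω.ext₃ hr).1) (ω.ext₃ hr).2.mids = j)) :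
    woundLimitSum Dl a f₀ hr j ≠ 0 := by
  rw [Ne, woundLimitSum_eq_zero_iff_of_mem_phases_above Dl a f₀ hr j hc hall]
  push Not
  obtain ⟨ω, hω, h⟩ := hex
  refine ⟨ω, hω, ?_⟩
  intro h1
  rcases h with h | h
  · exact absurd h h1
  · exact h

open Classical in
/-- ★★★ **THE ANTIPODE-FREE CRITERION, PHASES BELOW THE HOLE**: every member of cost `j` with `limitWeight ∈ {c, cζ⁸, cζ²⁰, cζ²⁸}` (`c ≠ 0`) ⟹ `woundLimitSum_j = 0` iff
there is no member of cost `j`. [cite: GlazmanManolescu2019, Lemma 2.1 (proof: the groups) and eq. (1)] -/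
theorem woundLimitSum_eq_zero_iff_of_mem_phases_below (hr : RootedFace (dom Dl) a f₀) (j : ℕ) {c : ℂ} (hc : c ≠ 0)
    (hall : ∀ ω ∈ (ΩG.setB2a (dom Dl) a f₀).filter (fun ω => ¬ω.Unwound hr),
      (cost (slotOfSide ω.1) ω.2.mids = j →
        (limitWeight (slotOfSide ω.1) ω.2.mids = c ∨ limitWeight (slotOfSide ω.1) ω.2.mids = c * zeta32 ^ 8 ∨
          limitWeight (slotOfSide ω.1) ω.2.mids = c * zeta32 ^ 20 ∨ limitWeight (slotOfSide ω.1) ω.2.mids = c * zeta32 ^ 28)) ∧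
      (IsNS ω hr → cost (slotOfSide (ω.ext₃ hr).1) (ω.ext₃ hr).2.mids = j →
        (limitWeight (slotOfSide (ω.ext₃ hr).1) (ω.ext₃ hr).2.mids = c ∨
          limitWeight (slotOfSide (ω.ext₃ hr).1) (ω.ext₃ hr).2.mids = c * zeta32 ^ 8 ∨
          limitWeight (slotOfSide (ω.ext₃ hr).1) (ω.ext₃ hr).2.mids = c * zeta32 ^ 20 ∨
          limitWeight (slotOfSide (ω.ext₃ hr).1) (ω.ext₃ hr).2.mids = c * zeta32 ^ 28))) :
    woundLimitSum Dl a f₀ hr j = 0 ↔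
      ∀ ω ∈ (ΩG.setB2a (dom Dl) a f₀).filter (fun ω => ¬ω.Unwound hr),
        cost (slotOfSide ω.1) ω.2.mids ≠ j ∧ ¬(IsNS ω hr ∧ cost (slotOfSide (ω.ext₃ hr).1) (ω.ext₃ hr).2.mids = j) := by
  rw [woundLimitSum_eq_sum_disjSum, sum_eq_zero_iff_of_mem_phases_below _ _ hc, Finset.disjSum_eq_empty, Finset.filter_eq_empty_iff,
    Finset.filter_eq_empty_iff]
  · constructor
    · rintro ⟨h1, h2⟩ ω hω; exact ⟨h1 hω, h2 hω⟩
    · intro h; exact ⟨fun ω hω => (h ω hω).1, fun ω hω => (h ω hω).2⟩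
  · intro x hx
    rcases x with ω | ω
    · rw [Finset.inl_mem_disjSum, Finset.mem_filter] at hx
      exact (hall ω hx.1).1 hx.2
    · rw [Finset.inr_mem_disjSum, Finset.mem_filter] at hx
      exact (hall ω hx.1).2 hx.2.1 hx.2.2

open Classical in
/-- ★★★ **… SO ONE MEMBER MAKES THE SUM NON-ZERO (phases below the hole).** [cite: GlazmanManolescu2019, Lemma 2.1 (proof: the groups) and eq. (1)] -/
theorem woundLimitSum_ne_zero_of_mem_phases_below (hr : RootedFace (dom Dl) a f₀) (j : ℕ) {c : ℂ} (hc : c ≠ 0)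
    (hall : ∀ ω ∈ (ΩG.setB2a (dom Dl) a f₀).filter (fun ω => ¬ω.Unwound hr),
      (cost (slotOfSide ω.1) ω.2.mids = j →
        (limitWeight (slotOfSide ω.1) ω.2.mids = c ∨ limitWeight (slotOfSide ω.1) ω.2.mids = c * zeta32 ^ 8 ∨
          limitWeight (slotOfSide ω.1) ω.2.mids = c * zeta32 ^ 20 ∨ limitWeight (slotOfSide ω.1) ω.2.mids = c * zeta32 ^ 28)) ∧
      (IsNS ω hr → cost (slotOfSide (ω.ext₃ hr).1) (ω.ext₃ hr).2.mids = j →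
        (limitWeight (slotOfSide (ω.ext₃ hr).1) (ω.ext₃ hr).2.mids = c ∨
          limitWeight (slotOfSide (ω.ext₃ hr).1) (ω.ext₃ hr).2.mids = c * zeta32 ^ 8 ∨
          limitWeight (slotOfSide (ω.ext₃ hr).1) (ω.ext₃ hr).2.mids = c * zeta32 ^ 20 ∨
          limitWeight (slotOfSide (ω.ext₃ hr).1) (ω.ext₃ hr).2.mids = c * zeta32 ^ 28)))
    (hex : ∃ ω ∈ (ΩG.setB2a (dom Dl) a f₀).filter (fun ω => ¬ω.Unwound hr),
      cost (slotOfSide ω.1) ω.2.mids = j ∨ (IsNS ω hr ∧ cost (slotOfSide (ω.ext₃ hr).1) (ω.ext₃ hr).2.mids = j)) :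
    woundLimitSum Dl a f₀ hr j ≠ 0 := by
  rw [Ne, woundLimitSum_eq_zero_iff_of_mem_phases_below Dl a f₀ hr j hc hall]
  push Not
  obtain ⟨ω, hω, h⟩ := hex
  refine ⟨ω, hω, ?_⟩
  intro h1
  rcases h with h | h
  · exact absurd h h1
  · exact h

end Criterion

end Literature.Barriers.CriticalPhenomena.PlaquetteWalk
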